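import Literature.Computability.AlgebraicComplexity.MS21ReadOnceHittingSetProofs
import Literature.Computability.AlgebraicComplexity.MS21ANFInterpolatingSetExistence
import HarnessLib

/-!
# Medini–Shpilka 2021, Thm 35 (interpolating-set generator for `ANF^{GLaff}`): the structure of
# `ANF_Δ` and the case of DISTINCT product depths `Δ₁ ≠ Δ₂`

Theorem-only companion of `MS21DenseOrbitsHittingSets.lean` (cell `val-lit`, seat x5 g3; registry
claim `MS2021_thm_35`, partial by design — second file). Source: D. Medini, A. Shpilka, CCC 2021
(LIPIcs 200:19) = arXiv:2102.05632, §5 (arXiv p0025–p0031).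

Contents (no definition, no named fact is added):

* **Structure of the canonical ROANF `ANF_Δ`** (Def 8 = Def 5.4, p0025:L28–L39): `ANF_Δ` is
  homogeneous of degree `2^Δ` (`isHomogeneous_anf`), nonzero (`anf_ne_zero`), of total degree
  exactly `2^Δ` (`totalDegree_anf`), and it IS a read-once polynomial on all `4^Δ` variables in the
  sense of Def 5 (`isROP_anf` — "Observe that any polynomial in `ANF_Δ^{GLaff_n(F)}` is an ANF",
  p0025:L41, and every ANF on distinct variables is a ROF); block embeddings are jointly injective
  (`anfBlock_inj`), read-once-ness is transported along injective renamings (`IsROP.rename`).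
* **Uniform maps respect the grading** (the role of "uniform" in Thm 35 / Thm 45, cf. Lemma
  `uniIndGenHitsHom`, p0027:L22–L30, and the degree comparison in the proof of Thm 45, p0036:L5–L8):
  if all coordinates of `G` are homogeneous of degree `e ≥ 1` then `(f ∘ G)^{[e·j]} = f^{[j]} ∘ G`
  (`homogeneousComponent_bind₁_of_isHomogeneous`), so `f ∘ G ≠ 0` as soon as ONE homogeneous
  component of `f` survives `G` (`bind₁_ne_zero_of_homogeneousComponent`); and `e ≥ 1` is
  automatic for a uniform `k`-independent map, `k, n ≥ 1` (`exists_pos_isHomogeneous_of_isUniform`).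
* **Top homogeneous component of an affine orbit**: for `g` homogeneous of degree `d`,
  `(g(Ax + b))^{[d]} = g(Ax)` (`homogeneousComponent_affSubst`; the paper's "`ANF(Ax+b)^{[2^Δ]} =
  ANF(Ax)`", p0028:L9).
* **`MS2021.bind₁_sub_ne_zero_of_mem_affOrbit_anf`**: if `f₁ ∈ ANF_Δ^{GLaff_n(F)}` and
  `deg f₂ < 2^Δ` then `(f₁ - f₂) ∘ G ≠ 0` for every UNIFORM `(t+1)`-independent `G` with
  `4^Δ ≤ 2^t` — the top component of `f₁ - f₂` is `ANF_Δ(Ax) ≠ 0`, a nonzero member of the affine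
  orbit of the read-once polynomial `ANF_Δ`, hit by Thm 33 in t18's strengthened form
  `bind₁_ne_zero_of_isROP_of_mem_affOrbit`, and the grading lifts this to `f₁ - f₂`.
* **`MS2021_thm_35_of_ne`** — the case `Δ₁ ≠ Δ₂` of the typed fact `MS2021_thm_35` (MS Thm 35 =
  arXiv ‹pitSumOfRoanfThm›, p0008:L29–30), EVERY field: with `Δ₂ < Δ₁`, `deg f₂ ≤ 2^{Δ₂} < 2^{Δ₁}`
  and `4^{Δ₁} ≤ 2^{2 max + 6}`. ROUTE vs PRINT (disclosed): the printed proof of this case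
  (p0030:L28–L31) differentiates along a vector dual to a leaf of `f₁` outside the span of the
  leaves of `f₂` and invokes Lemma 5.15; here the degree comparison that the paper uses for Thm 45
  (p0036:L5–L8) is used instead — it needs uniformity, which the typed statement supplies.
  Together with `MS2021_thm_35_of_max_le_three` (AC/MS21CoordinateProjectionHitting.lean) the
  residual of `MS2021_thm_35` is exactly `Δ₁ = Δ₂ ≥ 4` (the printed §5.2.1–§5.2.2 core).

HONEST FRAMING: partial results toward a typed literature statement; `VP ≠ VNP` is NOT proved and
nothing here bears on it.

## References
* [MediniShpilka2021] D. Medini, A. Shpilka, CCC 2021, LIPIcs 200:19 = arXiv:2102.05632: Def 8 /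
  Def 5.4 (CCC p.19:7; arXiv p0025:L28–L41), Def 19 (CCC p.19:9), Thm 33 (CCC p.19:13), Thm 35
  (CCC p.19:13; arXiv p0008:L29–30) and its proof §5.2 (p0026:L55–p0031), Lemma `uniIndGenHitsHom`
  (p0027:L22–L30), proof of Thm 45 (p0036:L5–L8).
-/

noncomputable section

open MvPolynomial

namespace Literature.Computability.AlgebraicComplexity

namespace MS2021

/-! ### Structure of `ANF_Δ`: block embeddings, homogeneity, non-vanishing, read-once-ness -/

section ANFStructure

variable (K : Type*) [Field K]

/-- Each block embedding is injective (`anfBlock_inj`, x6's file). [cite: MediniShpilka2021, Def 8 / Def 5.4 (CCC p.19:7; arXiv p0025:L31-L37)] -/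
theorem anfBlock_injective (Δ : ℕ) (i : Fin 4) : Function.Injective (anfBlock Δ i) :=
  fun _ _ h => (anfBlock_inj h).2

/-- Every variable of `ANF_{Δ+1}` lies in exactly one block. [cite: MediniShpilka2021, Def 8 / Def 5.4 (CCC p.19:7; arXiv p0025:L31-L37)] -/
theorem exists_eq_anfBlock (Δ : ℕ) (x : Fin (4 ^ (Δ + 1))) :
    ∃ i : Fin 4, ∃ j : Fin (4 ^ Δ), x = anfBlock Δ i j := by
  refine ⟨(finProdFinEquiv.symm (Fin.cast (pow_succ' 4 Δ) x)).1,
    (finProdFinEquiv.symm (Fin.cast (pow_succ' 4 Δ) x)).2, ?_⟩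
  unfold anfBlock
  rw [Prod.mk.eta, Equiv.apply_symm_apply]
  ext
  simp

/-- **`ANF_Δ` is homogeneous of degree `2^Δ`** ("the degree of every polynomial in `ANF^{GLaff}` is
always a power of `2`", arXiv p0026:L5). [cite: MediniShpilka2021, Def 8 / Def 5.4 (CCC p.19:7; arXiv p0025:L31-L39)] -/
theorem isHomogeneous_anf : ∀ Δ : ℕ, (anf K Δ).IsHomogeneous (2 ^ Δ)
  | 0 => by
    simp only [anf, pow_zero]
    exact isHomogeneous_X K _
  | Δ + 1 => by
    have ih := isHomogeneous_anf Δ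
    have hr : ∀ i : Fin 4, (rename (anfBlock Δ i) (anf K Δ)).IsHomogeneous (2 ^ Δ) :=
      fun i => ih.rename_isHomogeneous
    have h2 : 2 ^ (Δ + 1) = 2 ^ Δ + 2 ^ Δ := by ring
    simp only [anf]
    rw [h2]
    exact ((hr 0).mul (hr 1)).add ((hr 2).mul (hr 3))

/-- Products of the first two blocks live on variables of blocks `0, 1`; of the last two on blocks
`2, 3`: a monomial of `ANF_Δ(x^{(0)}) ANF_Δ(x^{(1)})` is supported in blocks `0 ∪ 1`. [folklore] -/
private theorem support_subset_blocks {Δ : ℕ} (i i' : Fin 4) (p q : MvPolynomial (Fin (4 ^ Δ)) K)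
    {μ : Fin (4 ^ (Δ + 1)) →₀ ℕ}
    (hμ : μ ∈ (rename (anfBlock Δ i) p * rename (anfBlock Δ i') q).support) :
    ∀ x ∈ μ.support, ∃ j, x = anfBlock Δ i j ∨ x = anfBlock Δ i' j := by
  classical
  intro x hx
  have hvars : x ∈ (rename (anfBlock Δ i) p * rename (anfBlock Δ i') q).vars := by
    rw [mem_vars_iff_mem_support]
    exact ⟨μ, hμ, hx⟩
  have h := vars_mul _ _ hvars
  rw [Finset.mem_union] at h
  rcases h with h | h
  · obtain ⟨j, -, rfl⟩ := Finset.mem_image.1 (vars_rename _ _ h)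
    exact ⟨j, Or.inl rfl⟩
  · obtain ⟨j, -, rfl⟩ := Finset.mem_image.1 (vars_rename _ _ h)
    exact ⟨j, Or.inr rfl⟩

/-- **`ANF_Δ ≠ 0`.** [cite: MediniShpilka2021, Def 8 / Def 5.4 (CCC p.19:7; arXiv p0025:L31-L39)] -/
theorem anf_ne_zero : ∀ Δ : ℕ, anf K Δ ≠ 0
  | 0 => by
    simp only [anf]
    exact X_ne_zero _
  | Δ + 1 => by
    classical
    have ih := anf_ne_zero Δ
    -- the first summand is nonzero and homogeneous of positive degree
    set P := rename (anfBlock Δ 0) (anf K Δ) * rename (anfBlock Δ 1) (anf K Δ) with hP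
    set Q := rename (anfBlock Δ 2) (anf K Δ) * rename (anfBlock Δ 3) (anf K Δ) with hQ
    have hr : ∀ i : Fin 4, rename (anfBlock Δ i) (anf K Δ) ≠ 0 := fun i h =>
      ih ((rename_injective _ (anfBlock_injective Δ i)).eq_iff' (map_zero _) |>.1 h)
    have hP0 : P ≠ 0 := mul_ne_zero (hr 0) (hr 1)
    have hPhom : P.IsHomogeneous (2 ^ Δ + 2 ^ Δ) :=
      ((isHomogeneous_anf K Δ).rename_isHomogeneous).mul ((isHomogeneous_anf K Δ).rename_isHomogeneous)
    show P + Q ≠ 0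
    intro hPQ
    obtain ⟨μ, hμ⟩ := Finset.nonempty_iff_ne_empty.2 (support_eq_empty.not.2 hP0)
    -- `μ` is a nonzero monomial supported in blocks 0 ∪ 1
    have hμdeg : μ.degree = 2 ^ Δ + 2 ^ Δ := hPhom.degree_eq_sum_deg_support hμ ▸ rfl
    have hμne : μ ≠ 0 := by
      intro h
      rw [h, map_zero] at hμdeg
      have : 0 < 2 ^ Δ := pow_pos (by norm_num) Δ
      omega
    obtain ⟨x, hx⟩ := Finset.nonempty_iff_ne_empty.2 (Finsupp.support_eq_empty.not.2 hμne)
    obtain ⟨j, hj⟩ := support_subset_blocks K 0 1 _ _ hμ x hx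
    -- but `coeff μ Q = - coeff μ P ≠ 0` would put `x` in blocks 2 ∪ 3
    have hcoeff : coeff μ Q = -coeff μ P := by
      have := congrArg (coeff μ) hPQ
      rw [coeff_add, coeff_zero] at this
      linear_combination this
    have hμQ : μ ∈ Q.support := by
      rw [mem_support_iff, hcoeff, neg_ne_zero]
      exact mem_support_iff.1 hμ
    obtain ⟨j', hj'⟩ := support_subset_blocks K 2 3 _ _ hμQ x hx
    rcases hj with h | h <;> rcases hj' with h' | h' <;>
      · have := (anfBlock_inj (h.symm.trans h')).1
        exact absurd this (by decide)

/-- **`deg ANF_Δ = 2^Δ`.** [cite: MediniShpilka2021, Def 8 / Def 5.4 (CCC p.19:7; arXiv p0025:L31-L39, p0026:L5)] -/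
theorem totalDegree_anf (Δ : ℕ) : (anf K Δ).totalDegree = 2 ^ Δ :=
  (isHomogeneous_anf K Δ).totalDegree (anf_ne_zero K Δ)

/-- **`ANF_Δ` is a read-once polynomial on all its `4^Δ` variables** (Def 5 / Def 5.1: the canonical
ROANF is a read-once formula — leaves `1·x_i + 0`, gates `· ∗ · + 0` on disjoint blocks).
[cite: MediniShpilka2021, Def 5 and Def 8 (CCC p.19:6-7; arXiv p0025:L9-L13, L28-L41)] -/
theorem isROP_anf : ∀ Δ : ℕ, IsROP (Finset.univ : Finset (Fin (4 ^ Δ))) (anf K Δ)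
  | 0 => by
    classical
    have h1 : anf K 0 = C 1 * X (⟨0, by norm_num⟩ : Fin (4 ^ 0)) + C 0 := by
      simp only [anf, map_one, one_mul, map_zero, add_zero]
    have h2 : (Finset.univ : Finset (Fin (4 ^ 0))) = {⟨0, by norm_num⟩} := by
      ext x
      simp only [Finset.mem_univ, Finset.mem_singleton, true_iff]
      ext
      have := x.2
      simp only [pow_zero] at this
      simp only
      omega
    rw [h1, h2]
    exact IsROP.leaf _ 1 0
  | Δ + 1 => by
    classical
    have ih := isROP_anf Δ
    -- the four renamed copies, on the four (pairwise disjoint) blocks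
    let U : Fin 4 → Finset (Fin (4 ^ (Δ + 1))) := fun i =>
      (Finset.univ : Finset (Fin (4 ^ Δ))).image (anfBlock Δ i)
    have hr : ∀ i : Fin 4, IsROP (U i) (rename (anfBlock Δ i) (anf K Δ)) :=
      fun i => ih.rename _ (anfBlock_injective Δ i)
    have hdisj : ∀ i i' : Fin 4, i ≠ i' → Disjoint (U i) (U i') := by
      intro i i' hii'
      rw [Finset.disjoint_left]
      intro x hx hx'
      obtain ⟨j, -, rfl⟩ := Finset.mem_image.1 hx
      obtain ⟨j', -, hjj'⟩ := Finset.mem_image.1 hx'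
      exact hii' (anfBlock_inj hjj'.symm).1
    have h01 := IsROP.mul 0 (hr 0) (hr 1) (hdisj 0 1 (by decide))
    have h23 := IsROP.mul 0 (hr 2) (hr 3) (hdisj 2 3 (by decide))
    have hdisj' : Disjoint (U 0 ∪ U 1) (U 2 ∪ U 3) := by
      rw [Finset.disjoint_union_left, Finset.disjoint_union_right, Finset.disjoint_union_right]
      exact ⟨⟨hdisj 0 2 (by decide), hdisj 0 3 (by decide)⟩, hdisj 1 2 (by decide), hdisj 1 3 (by decide)⟩
    have hsum := IsROP.add 0 h01 h23 hdisj'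
    simp only [map_zero, add_zero] at hsum
    have huniv : (U 0 ∪ U 1) ∪ (U 2 ∪ U 3) = (Finset.univ : Finset (Fin (4 ^ (Δ + 1)))) := by
      rw [← Finset.univ_subset_iff]
      intro x _
      obtain ⟨i, j, rfl⟩ := exists_eq_anfBlock Δ x
      have hmem : anfBlock Δ i j ∈ U i := Finset.mem_image.2 ⟨j, Finset.mem_univ _, rfl⟩
      simp only [Finset.mem_union]
      fin_cases i
      · exact Or.inl (Or.inl hmem)
      · exact Or.inl (Or.inr hmem)
      · exact Or.inr (Or.inl hmem)
      · exact Or.inr (Or.inr hmem)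
    rw [huniv] at hsum
    simpa only [anf] using hsum

end ANFStructure

/-! ### Uniform maps respect the grading -/

section Grading

variable {K : Type*} [Field K] {n : ℕ} {τ : Type*}

/-- If every coordinate of `G` is homogeneous of degree `e`, then `f^{[j]} ∘ G` is homogeneous of
degree `e · j`. [cite: MediniShpilka2021, Lemma uniIndGenHitsHom and proof of Thm 45 (arXiv p0027:L22-L30, p0036:L5-L8)] -/
theorem isHomogeneous_bind₁_homogeneousComponent {G : Fin n → MvPolynomial τ K} {e : ℕ}
    (hG : ∀ i, (G i).IsHomogeneous e) (f : MvPolynomial (Fin n) K) (j : ℕ) :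
    (bind₁ G (homogeneousComponent j f)).IsHomogeneous (e * j) := by
  rw [← aeval_eq_bind₁]
  exact (homogeneousComponent_isHomogeneous j f).aeval G hG

/-- **Uniform maps respect the grading**: if every coordinate of `G` is homogeneous of degree
`e ≥ 1`, then `(f ∘ G)^{[e·j]} = f^{[j]} ∘ G` ("as all coordinates of `G` are homogeneous and of
identical degree … nothing can cancel", arXiv p0027:L29-L30).
[cite: MediniShpilka2021, Lemma uniIndGenHitsHom and proof of Thm 45 (arXiv p0027:L22-L30, p0036:L5-L8)] -/
theorem homogeneousComponent_bind₁_of_isHomogeneous {G : Fin n → MvPolynomial τ K} {e : ℕ}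
    (hG : ∀ i, (G i).IsHomogeneous e) (he : 0 < e) (f : MvPolynomial (Fin n) K) (j : ℕ) :
    homogeneousComponent (e * j) (bind₁ G f) = bind₁ G (homogeneousComponent j f) := by
  classical
  conv_lhs => rw [← sum_homogeneousComponent f, map_sum]
  rw [map_sum]
  have hterm : ∀ i, homogeneousComponent (e * j) (bind₁ G (homogeneousComponent i f)) =
      if i = j then bind₁ G (homogeneousComponent j f) else 0 := by
    intro i
    rw [homogeneousComponent_of_mem (isHomogeneous_bind₁_homogeneousComponent hG f i)]
    by_cases hij : i = j
    · subst hij; simp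
    · have : e * j ≠ e * i := fun h => hij (Nat.eq_of_mul_eq_mul_left he h).symm
      rw [if_neg this, if_neg hij]
  simp_rw [hterm]
  rw [Finset.sum_ite_eq' (Finset.range (f.totalDegree + 1)) j]
  split_ifs with hj
  · rfl
  · rw [Finset.mem_range, not_lt] at hj
    rw [homogeneousComponent_eq_zero j f (by omega), map_zero]

/-- **Degree separation**: if the coordinates of `G` are homogeneous of a common degree `e ≥ 1` and
SOME homogeneous component of `f` survives `G`, then `f ∘ G ≠ 0`.
[cite: MediniShpilka2021, Lemma uniIndGenHitsHom and proof of Thm 45 (arXiv p0027:L22-L30, p0036:L5-L8)] -/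
theorem bind₁_ne_zero_of_homogeneousComponent {G : Fin n → MvPolynomial τ K} {e : ℕ}
    (hG : ∀ i, (G i).IsHomogeneous e) (he : 0 < e) {f : MvPolynomial (Fin n) K} {j : ℕ}
    (h : bind₁ G (homogeneousComponent j f) ≠ 0) : bind₁ G f ≠ 0 := by
  intro h0
  apply h
  rw [← homogeneousComponent_bind₁_of_isHomogeneous hG he, h0]
  exact map_zero _

variable {t : ℕ}

/-- The common degree of a UNIFORM `k`-independent map into `F^n` (`k, n ≥ 1`) is positive: the block
evaluation at `i` sends `G_i ↦ z`, which no constant does.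
[cite: MediniShpilka2021, Def 19 (CCC p.19:9; arXiv ‹Def 1.15› p0006:L64-67)] -/
theorem exists_pos_isHomogeneous_of_isUniform {k : ℕ}
    {G : Fin n → MvPolynomial (Fin k × (Fin t ⊕ Unit)) K} (hG : IsIndependent k G)
    (hU : IsUniform G) (hk : 1 ≤ k) (i : Fin n) :
    ∃ e, 0 < e ∧ ∀ j, (G j).IsHomogeneous e := by
  classical
  obtain ⟨e, he⟩ := hU
  refine ⟨e, Nat.pos_of_ne_zero ?_, he⟩
  intro he0
  subst he0
  obtain ⟨φ, hφ⟩ := hG.exists_aeval_eq_single hk i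
  have hGi : G i = C (coeff 0 (G i)) := by
    rw [← totalDegree_eq_zero_iff_eq_C, ← Nat.le_zero]
    exact (he i).totalDegree_le
  have h1 := hφ i
  rw [if_pos rfl, hGi, algHom_C, MvPolynomial.algebraMap_eq] at h1
  have h2 := congrArg MvPolynomial.totalDegree h1
  rw [totalDegree_C, totalDegree_X] at h2
  exact zero_ne_one h2

end Grading

/-! ### The top homogeneous component of an affine substitution -/

section TopComponent

variable {K : Type*} [Field K] {m n : ℕ}

/-- Top component of a product: if `P = P' + (deg < a)` and `Q = Q' + (deg < b)` with `P', Q'`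
homogeneous of degrees `a, b`, then `PQ = P'Q' + (deg < a + b)`. [folklore] -/
private theorem top_mul {σ : Type*} {a b : ℕ} {P P' Q Q' : MvPolynomial σ K}
    (hP' : P'.IsHomogeneous a) (hP : ∀ μ ∈ (P - P').support, μ.degree < a)
    (hQ' : Q'.IsHomogeneous b) (hQ : ∀ μ ∈ (Q - Q').support, μ.degree < b) :
    ∀ μ ∈ (P * Q - P' * Q').support, μ.degree < a + b := by
  classical
  intro μ hμ
  have hsplit : P * Q - P' * Q' = P' * (Q - Q') + (P - P') * Q' + (P - P') * (Q - Q') := by ring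
  rw [hsplit] at hμ
  -- degrees on the support of each product
  have hdeg : ∀ {R S : MvPolynomial σ K} {c d : ℕ},
      (∀ ν ∈ R.support, ν.degree ≤ c) → (∀ ν ∈ S.support, ν.degree ≤ d) →
      ((∀ ν ∈ R.support, ν.degree < c) ∨ (∀ ν ∈ S.support, ν.degree < d)) →
      ∀ ν ∈ (R * S).support, ν.degree < c + d := by
    intro R S c d hR hS hlt ν hν
    obtain ⟨α, hα, β, hβ, rfl⟩ := Finset.mem_add.1 (support_mul R S hν)
    rw [map_add]
    rcases hlt with h | h
    · exact add_lt_add_of_lt_of_le (h α hα) (hS β hβ)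
    · exact add_lt_add_of_le_of_lt (hR α hα) (h β hβ)
  have hP'le : ∀ ν ∈ P'.support, ν.degree ≤ a := fun ν hν =>
    (hP'.degree_eq_sum_deg_support hν ▸ le_rfl : ν.degree ≤ a)
  have hQ'le : ∀ ν ∈ Q'.support, ν.degree ≤ b := fun ν hν =>
    (hQ'.degree_eq_sum_deg_support hν ▸ le_rfl : ν.degree ≤ b)
  have hPle : ∀ ν ∈ (P - P').support, ν.degree ≤ a := fun ν hν => (hP ν hν).le
  have hQle : ∀ ν ∈ (Q - Q').support, ν.degree ≤ b := fun ν hν => (hQ ν hν).le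
  rcases Finset.mem_union.1 (support_add hμ) with h | h
  · rcases Finset.mem_union.1 (support_add h) with h | h
    · exact hdeg hP'le hQle (Or.inr hQ) μ h
    · exact hdeg hPle hQ'le (Or.inl hP) μ h
  · exact hdeg hPle hQle (Or.inl hP) μ h

/-- Top component of a power of an affine form: `(L + c)^r = L^r + (deg < r)` for `L` homogeneous
of degree `1`. [folklore] -/
private theorem top_pow {σ : Type*} {L : MvPolynomial σ K} (hL : L.IsHomogeneous 1) (c : K) :
    ∀ r : ℕ, ∀ μ ∈ ((L + C c) ^ r - L ^ r).support, μ.degree < r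
  | 0 => by simp
  | r + 1 => by
    have ih := top_pow hL c r
    have h1 : ∀ μ ∈ ((L + C c) - L).support, μ.degree < 1 := by
      intro μ hμ
      rw [add_sub_cancel_left] at hμ
      classical
      rw [mem_support_iff, coeff_C] at hμ
      split_ifs at hμ with h
      · rw [← h, map_zero]; exact zero_lt_one
      · exact absurd rfl hμ
    have hr : (L ^ r).IsHomogeneous r := by simpa using hL.pow r
    rw [pow_succ, pow_succ]
    exact top_mul hr ih hL h1

/-- Top component of a product of powers of affine forms over a finset. [folklore] -/
private theorem top_prod {σ ι : Type*} (s : Finset ι) (L : ι → MvPolynomial σ K)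
    (hL : ∀ i, (L i).IsHomogeneous 1) (c : ι → K) (r : ι → ℕ) :
    ∀ μ ∈ ((∏ i ∈ s, (L i + C (c i)) ^ r i) - ∏ i ∈ s, L i ^ r i).support,
      μ.degree < ∑ i ∈ s, r i := by
  classical
  induction s using Finset.induction_on with
  | empty => simp
  | insert a s ha ih =>
    rw [Finset.prod_insert ha, Finset.prod_insert ha, Finset.sum_insert ha]
    have hhom : (∏ i ∈ s, L i ^ r i).IsHomogeneous (∑ i ∈ s, r i) :=
      IsHomogeneous.prod s (fun i => L i ^ r i) r fun i _ => by
        simpa [mul_comm] using (hL i).pow (r i)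
    exact top_mul (by simpa using (hL a).pow (r a)) (top_pow (hL a) (c a) (r a)) hhom ih

/-- **The top homogeneous component of an affine orbit**: for `g` homogeneous of degree `d`,
`(g(Ax + b))^{[d]} = g(Ax)` ("`ANF(Ax+b)^{[2^Δ]} = ANF(Ax)`", arXiv p0028:L9; the degree-`d` part of
`∏ (ℓ_i(x) + b_i)^{μ_i}` is `∏ ℓ_i(x)^{μ_i}`).
[cite: MediniShpilka2021, §1.1.6 eq. (2) and proof of Lemma 5.12 (arXiv p0007:L7-L18, p0028:L9)] -/
theorem homogeneousComponent_affSubst {d : ℕ} (h : m ≤ n) (A : Matrix (Fin n) (Fin n) K)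
    (b : Fin n → K) {g : MvPolynomial (Fin m) K} (hg : g.IsHomogeneous d) :
    homogeneousComponent d (affSubst h A b g) = affSubst h A 0 g := by
  classical
  -- the linear forms and their homogeneity
  set L : Fin m → MvPolynomial (Fin n) K := fun i => ∑ j : Fin n, C (A (Fin.castLE h i) j) * X j
    with hL
  have hLhom : ∀ i, (L i).IsHomogeneous 1 := fun i =>
    IsHomogeneous.sum _ _ _ fun j _ => isHomogeneous_C_mul_X _ _
  have hfun0 : (fun i : Fin m => (∑ j : Fin n, C (A (Fin.castLE h i) j) * X j) +
      C ((0 : Fin n → K) (Fin.castLE h i))) = L := by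
    funext i
    simp [hL]
  have hsub0 : affSubst h A 0 g = aeval L g := by
    unfold affSubst
    rw [hfun0]
  have hsubb : affSubst h A b g = aeval (fun i => L i + C (b (Fin.castLE h i))) g := rfl
  -- `g(Ax)` is homogeneous of degree `d`
  have hhom0 : (affSubst h A 0 g).IsHomogeneous d := by
    rw [hsub0]
    simpa using hg.aeval L hLhom
  -- the difference has only monomials of degree `< d`
  have hdiff : ∀ μ ∈ (affSubst h A b g - affSubst h A 0 g).support, μ.degree < d := by
    rw [hsubb, hsub0]
    intro μ hμ
    have hexp : aeval (fun i => L i + C (b (Fin.castLE h i))) g - aeval L g =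
        ∑ ν ∈ g.support, C (coeff ν g) *
          ((∏ i ∈ ν.support, (L i + C (b (Fin.castLE h i))) ^ ν i) - ∏ i ∈ ν.support, L i ^ ν i) := by
      conv_lhs => rw [g.as_sum, map_sum, map_sum, ← Finset.sum_sub_distrib]
      refine Finset.sum_congr rfl fun ν _ => ?_
      rw [aeval_monomial, aeval_monomial, MvPolynomial.algebraMap_eq, Finsupp.prod, Finsupp.prod,
        mul_sub]
    rw [hexp] at hμ
    obtain ⟨ν, hν, hμν⟩ := Finset.mem_biUnion.1 (support_sum hμ)
    have hμ' := support_mul _ _ hμν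
    rw [Finset.mem_add] at hμ'
    obtain ⟨α, hα, β, hβ, rfl⟩ := hμ'
    rw [mem_support_iff, coeff_C] at hα
    split_ifs at hα with h0
    · subst h0
      rw [zero_add]
      have := top_prod ν.support L hLhom (fun i => b (Fin.castLE h i)) ν β hβ
      have hνd' : ∑ i ∈ ν.support, ν i = d := (hg.degree_eq_sum_deg_support hν).symm
      rwa [hνd'] at this
    · exact absurd rfl hα
  -- conclude
  have hsplit : affSubst h A b g = affSubst h A 0 g + (affSubst h A b g - affSubst h A 0 g) := by ring
  rw [hsplit, map_add, homogeneousComponent_eq_self hhom0,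
    homogeneousComponent_eq_zero' d _ (fun μ hμ => (hdiff μ hμ).ne), add_zero]

end TopComponent

/-! ### `ANF_Δ(Ax+b) - (lower degree)` is hit by uniform `(t+1)`-independent maps, `4^Δ ≤ 2^t` -/

section Hitting

variable {K : Type} [Field K] {n t c : ℕ}

/-- **An affine image of `ANF_Δ` minus anything of lower degree is hit by every uniform
`(t+1)`-independent map with `4^Δ ≤ 2^t`**: the top component of `f₁ - f₂` is `ANF_Δ(Ax) ≠ 0`, a
nonzero member of the affine orbit of the read-once polynomial `ANF_Δ` (Thm 33, in the
strengthened form `bind₁_ne_zero_of_isROP_of_mem_affOrbit`), and uniform maps respect the grading.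
[cite: MediniShpilka2021, Thm 35 and its proof, case `Δ₁ ≠ Δ₂` (CCC p.19:13; arXiv p0008:L29-30, p0030:L28-L31); Thm 33] -/
theorem bind₁_sub_ne_zero_of_mem_affOrbit_anf {Δ : ℕ} {f₁ f₂ : MvPolynomial (Fin n) K}
    (hf₁ : f₁ ∈ affOrbit n (anf K Δ)) (hf₂ : f₂.totalDegree < 2 ^ Δ) (ht : 4 ^ Δ ≤ 2 ^ t)
    {G : Fin n → MvPolynomial (Fin (t + 1) × (Fin c ⊕ Unit)) K} (hG : IsIndependent (t + 1) G)
    (hU : IsUniform G) : bind₁ G (f₁ - f₂) ≠ 0 := by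
  classical
  obtain ⟨h, A, b, hA, rfl⟩ := hf₁
  have hn : 0 < n := lt_of_lt_of_le (pow_pos (by norm_num) Δ) h
  obtain ⟨e, he, hGe⟩ := exists_pos_isHomogeneous_of_isUniform hG hU (Nat.succ_pos t) ⟨0, hn⟩
  refine bind₁_ne_zero_of_homogeneousComponent hGe he (j := 2 ^ Δ) ?_
  -- the top component of `f₁ - f₂` is `ANF_Δ(Ax)`
  have htop : homogeneousComponent (2 ^ Δ) (affSubst h A b (anf K Δ) - f₂) =
      affSubst h A 0 (anf K Δ) := by
    rw [map_sub, homogeneousComponent_affSubst h A b (isHomogeneous_anf K Δ),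
      homogeneousComponent_eq_zero (2 ^ Δ) f₂ hf₂, sub_zero]
  rw [htop]
  -- which is a nonzero member of the affine orbit of the read-once polynomial `ANF_Δ`
  have hmem : affSubst h A 0 (anf K Δ) ∈ affOrbit n (anf K Δ) := ⟨h, A, 0, hA, rfl⟩
  have hne : affSubst h A 0 (anf K Δ) ≠ 0 := by
    intro h0
    have hdeg := totalDegree_affSubst h hA 0 (anf K Δ)
    rw [h0, totalDegree_zero, totalDegree_anf] at hdeg
    exact absurd hdeg.symm (pow_ne_zero Δ (by norm_num))
  have hcard : (Finset.univ : Finset (Fin (4 ^ Δ))).card ≤ 2 ^ t := by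
    rwa [Finset.card_univ, Fintype.card_fin]
  exact bind₁_ne_zero_of_isROP_of_mem_affOrbit (isROP_anf K Δ) hcard hmem hne hG

end Hitting

end MS2021

/-! ### Thm 35 for `Δ₁ ≠ Δ₂` -/

section Thm35Ne

open MS2021

/-- **MS Thm 35, case `Δ₁ ≠ Δ₂`**, every field: if `f₁ ∈ ANF_{Δ₁}^{GLaff_n(F)}`,
`f₂ ∈ ANF_{Δ₂}^{GLaff_n(F)}`, `Δ₁ ≠ Δ₂` and `f₁ - f₂ ≠ 0`, then `(f₁ - f₂) ∘ G ≠ 0` for every UNIFORM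
`(2 max{Δ₁, Δ₂} + 7)`-independent `G`. (Route: degree comparison under the uniform map + Thm 33 on
the top component; the printed argument for this case uses Lemma 5.15 instead — disclosed in the
module docstring.) [cite: MediniShpilka2021, Thm 35 (CCC p.19:13; = arXiv ‹pitSumOfRoanfThm› p0008.txt:L29-30); proof p0030:L28-L31] -/
theorem MS2021_thm_35_of_ne (K : Type) [Field K] (n Δ₁ Δ₂ c : ℕ) (hΔ : Δ₁ ≠ Δ₂) :
    ∀ f₁ ∈ affOrbit n (anf K Δ₁), ∀ f₂ ∈ affOrbit n (anf K Δ₂), f₁ - f₂ ≠ 0 →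
      ∀ G : Fin n → MvPolynomial (Fin (2 * max Δ₁ Δ₂ + 7) × (Fin c ⊕ Unit)) K,
        IsIndependent (2 * max Δ₁ Δ₂ + 7) G → IsUniform G → bind₁ G (f₁ - f₂) ≠ 0 := by
  intro f₁ hf₁ f₂ hf₂ _ G hG hU
  -- `deg f_i ≤ 2^{Δ_i}` and `4^{Δ_i} ≤ 2^{2 max + 6}`
  have hdeg : ∀ {Δ : ℕ} {f : MvPolynomial (Fin n) K}, f ∈ affOrbit n (anf K Δ) →
      f.totalDegree ≤ 2 ^ Δ := by
    intro Δ f hf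
    obtain ⟨h, A, b, -, rfl⟩ := hf
    exact (totalDegree_affSubst_le h A b _).trans (Cor36.totalDegree_anf_le Δ)
  have hfour : ∀ {Δ : ℕ}, Δ ≤ max Δ₁ Δ₂ → 4 ^ Δ ≤ 2 ^ (2 * max Δ₁ Δ₂ + 6) := by
    intro Δ hΔ
    calc 4 ^ Δ = 2 ^ (2 * Δ) := by rw [pow_mul]; norm_num
      _ ≤ 2 ^ (2 * max Δ₁ Δ₂ + 6) := Nat.pow_le_pow_right (by norm_num) (by omega)
  rcases lt_or_gt_of_ne hΔ with hlt | hlt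
  · -- `Δ₁ < Δ₂`: swap the roles
    have h2 : f₁.totalDegree < 2 ^ Δ₂ :=
      lt_of_le_of_lt (hdeg hf₁) (Nat.pow_lt_pow_right (by norm_num) hlt)
    have key := bind₁_sub_ne_zero_of_mem_affOrbit_anf (t := 2 * max Δ₁ Δ₂ + 6) hf₂ h2
      (hfour (le_max_right _ _)) hG hU
    intro h0
    apply key
    rw [← neg_sub, map_neg, h0, neg_zero]
  · -- `Δ₂ < Δ₁`
    have h1 : f₂.totalDegree < 2 ^ Δ₁ :=
      lt_of_le_of_lt (hdeg hf₂) (Nat.pow_lt_pow_right (by norm_num) hlt)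
    exact bind₁_sub_ne_zero_of_mem_affOrbit_anf (t := 2 * max Δ₁ Δ₂ + 6) hf₁ h1
      (hfour (le_max_left _ _)) hG hU

end Thm35Ne

end Literature.Computability.AlgebraicComplexity

end
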